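import Mathlib
import Summits.SmoothPoincare4.SmoothPoincare4.Theses.CylinderEntropy

/-!
# Sketch — crux-ideate stmt-SmoothPoincare4-7633 (ThinCrossSectionExists), ideator 3, round 1

First lemmas of the three idea cards (signatures only; `sorry` bodies are intentional — the
crux-ideate contract asks that the statements ELABORATE, not that they be proved).

* `cylEnt`, `SeparatesEnds` — verbatim abbreviations of the sub-expressions of the route item
  `Summit.SmoothPoincare4.SmoothPoincare4.Theses.CylinderEntropy.ThinCrossSectionExists`.
* card `junction-cost-table`   → `wedge_fat`
* card `implant-and-saturate`  → `areaBudget`, `PlanarThinModelExists`, `implant`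
* card `funnels-not-walls`     → `wall_cost`
-/

open scoped BigOperators ENNReal Manifold ContDiff Topology ContinuousMap
set_option linter.dupNamespace false
open MeasureTheory

namespace Summit.SmoothPoincare4.SmoothPoincare4.Cruxes.ThinCrossSectionExists.Sketch

noncomputable section

/-- Cylinder entropy of a subset of `N = S⁴×ℝ ⊂ ℝ⁶`: the `⨆` sub-expression of the route items,
copied verbatim (slice-normalised Gegenbauer heat-kernel Gaussian area). -/
def cylEnt (A : Set (EuclideanSpace ℝ (Fin 6))) : ℝ≥0∞ :=
  ⨆ (p : EuclideanSpace ℝ (Fin 6)) (_ : ∑ i : Fin 5, p (Fin.castSucc i) ^ 2 = 1) (τ : ℝ) (_ : 0 < τ),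
    (μH[4] (Metric.sphere (0 : EuclideanSpace ℝ (Fin 5)) 1))⁻¹ *
      ∫⁻ z in A, ENNReal.ofReal ((∑' k : ℕ, Real.exp (-((k : ℝ) * ((k : ℝ) + 3)) * τ) *
        ((2 * (k : ℝ) + 3) / 3) * ∑ l ∈ Finset.range (k / 2 + 1), (-1 : ℝ) ^ l *
          (∏ j ∈ Finset.range (k - l), ((3 : ℝ) / 2 + (j : ℝ))) /
            (((l.factorial : ℕ) : ℝ) * (((k - 2 * l).factorial : ℕ) : ℝ)) *
          (2 * ∑ i : Fin 5, z (Fin.castSucc i) * p (Fin.castSucc i)) ^ (k - 2 * l)) *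
        Real.exp (-((z 5 - p 5) ^ 2) / (4 * τ))) ∂μH[4]

/-- "separates the two ends of N": the `∃ R, …` sub-expression of the route items, verbatim. -/
def SeparatesEnds (A : Set (EuclideanSpace ℝ (Fin 6))) : Prop :=
  ∃ R : ℝ, ∀ a b : EuclideanSpace ℝ (Fin 6), ∑ i : Fin 5, a (Fin.castSucc i) ^ 2 = 1 →
    ∑ i : Fin 5, b (Fin.castSucc i) ^ 2 = 1 → a 5 ≤ -R → R ≤ b 5 →
      ¬ JoinedIn ({z : EuclideanSpace ℝ (Fin 6) | ∑ i : Fin 5, z (Fin.castSucc i) ^ 2 = 1} \ A) a b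

/-- Sanity: the crux is literally `∀ M ≃ₕ S⁴, ∃ ι, embedding ∧ in N ∧ SeparatesEnds ∧ cylEnt < 4/e`. -/
example : Summit.SmoothPoincare4.SmoothPoincare4.Theses.CylinderEntropy.ThinCrossSectionExists ↔
    ∀ (M : Type) [TopologicalSpace M] [T2Space M] [SecondCountableTopology M]
      [ChartedSpace (EuclideanSpace ℝ (Fin 4)) M] [IsManifold (𝓡 4) ∞ M],
      M ≃ₕ Metric.sphere (0 : EuclideanSpace ℝ (Fin 5)) 1 →
      ∃ ι : M → EuclideanSpace ℝ (Fin 6), Manifold.IsSmoothEmbedding (𝓡 4) (𝓡 6) ∞ ι ∧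
        (∀ x, ∑ i : Fin 5, ι x (Fin.castSucc i) ^ 2 = 1) ∧ SeparatesEnds (Set.range ι) ∧
        cylEnt (Set.range ι) < ENNReal.ofReal (4 / Real.exp 1) :=
  Iff.rfl

/-! ## Card `implant-and-saturate` -/

/-- FIRST LEMMA (area budget, the `τ → ∞` end of the scale separation): a thin cross-section has
total 4-area `< (4/e)·vol(S⁴)`, i.e. at most `0.4715·vol(S⁴) ≈ 12.4` of area beyond a slice.
Proof idea: `F̂_{p,τ}(M) → μH[4](M)/μH[4](S⁴)` as `τ → ∞` (the Gegenbauer series tends to its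
`k = 0` mode `1`, the vertical Gaussian to `1`, monotone convergence), and `F̂ ≤ cylEnt`. -/
theorem areaBudget
    (M : Type) [TopologicalSpace M] [T2Space M] [SecondCountableTopology M]
    [ChartedSpace (EuclideanSpace ℝ (Fin 4)) M] [IsManifold (𝓡 4) ∞ M]
    (ι : M → EuclideanSpace ℝ (Fin 6)) (hι : Manifold.IsSmoothEmbedding (𝓡 4) (𝓡 6) ∞ ι)
    (hN : ∀ x, ∑ i : Fin 5, ι x (Fin.castSucc i) ^ 2 = 1) (hsep : SeparatesEnds (Set.range ι))
    (hthin : cylEnt (Set.range ι) < ENNReal.ofReal (4 / Real.exp 1)) :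
    μH[4] (Set.range ι) <
      ENNReal.ofReal (4 / Real.exp 1) * μH[4] (Metric.sphere (0 : EuclideanSpace ℝ (Fin 5)) 1) := by
  sorry

/-- Colding–Minicozzi Gaussian area / entropy of a subset of `ℝ⁵` (hyperplane ↦ 1). -/
def ent5 (A : Set (EuclideanSpace ℝ (Fin 5))) : ℝ≥0∞ :=
  ⨆ (p : EuclideanSpace ℝ (Fin 5)) (t : ℝ) (_ : 0 < t),
    (ENNReal.ofReal ((4 * Real.pi * t) ^ 2))⁻¹ *
      ∫⁻ x in A, ENNReal.ofReal (Real.exp (-(‖x - p‖ ^ 2) / (4 * t))) ∂μH[4]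

/-- `E♭`: every homotopy 4-sphere `M` has a PLANAR-ENDED THIN MODEL of `M ∖ {x₀}`: a smooth proper
embedding of the punctured manifold into `ℝ⁵` which is the hyperplane `{y₄ = 0}` outside a ball and
has Euclidean entropy `< 4/e`. (The `τ → 0` end of the scale separation: implanting a
`δ`-rescaled model into a slice gives `E♭ → E`; implanting it onto a large round `S⁴ ⊂ ℝ⁵` and
[ChodoshMantoulidisSchulze2025, Cor 1.5(b)] gives `E♭(M) → M ≅ S⁴`.) -/
def PlanarThinModelExists : Prop :=
  ∀ (M : Type) [TopologicalSpace M] [T2Space M] [SecondCountableTopology M]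
    [ChartedSpace (EuclideanSpace ℝ (Fin 4)) M] [IsManifold (𝓡 4) ∞ M],
    M ≃ₕ Metric.sphere (0 : EuclideanSpace ℝ (Fin 5)) 1 →
    ∃ (x₀ : M) (j : (⟨{x₀}ᶜ, isOpen_compl_singleton⟩ : TopologicalSpace.Opens M) →
        EuclideanSpace ℝ (Fin 5)),
      Manifold.IsSmoothEmbedding (𝓡 4) (𝓡 5) ∞ j ∧
      (∃ R : ℝ, 0 < R ∧ {y : EuclideanSpace ℝ (Fin 5) | y 4 = 0 ∧ R < ‖y‖} ⊆ Set.range j ∧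
        Set.range j ⊆ {y | y 4 = 0} ∪ Metric.closedBall 0 R) ∧
      ent5 (Set.range j) < ENNReal.ofReal (4 / Real.exp 1)

/-- IMPLANT LEMMA (transfer direction `E♭ → E`). -/
theorem implant : PlanarThinModelExists →
    Summit.SmoothPoincare4.SmoothPoincare4.Theses.CylinderEntropy.ThinCrossSectionExists := by
  sorry

/-! ## Card `junction-cost-table` -/

/-- FIRST LEMMA (wedge row of the cost table, pure real analysis): two half-lines from the origin
of `ℝ²` at angle `θ ≤ π/4`, weighted by the one-dimensional heat kernel at scale `τ = 1/2`
(`(2π)^{-1/2} e^{-d²/2}`, a full line through the centre weighs `1`), have Gaussian weight `> 4/e`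
at some centre `(c₁, c₂)`. Geometric reading (the card): a cross-section of `S⁴×ℝ` whose blow-down
at a fold is a wedge `ℝ³ × (two rays at angle θ ≤ 45°)` has `cylEnt ≥ 4/e` (Gaussian area is
multiplicative over the `ℝ³` factor and lower semicontinuous under blow-down). Kit job j007321
locates the true threshold `θ*` (hand estimate ≈ 55°). -/
theorem wedge_fat : ∀ θ : ℝ, 0 < θ → θ ≤ Real.pi / 4 →
    ∃ c₁ c₂ : ℝ, 4 / Real.exp 1 <
      (∫ t in Set.Ioi (0 : ℝ), (2 * Real.pi)⁻¹ ^ ((1 : ℝ) / 2) *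
          Real.exp (-((t - c₁) ^ 2 + c₂ ^ 2) / 2)) +
      (∫ t in Set.Ioi (0 : ℝ), (2 * Real.pi)⁻¹ ^ ((1 : ℝ) / 2) *
          Real.exp (-((t * Real.cos θ - c₁) ^ 2 + (t * Real.sin θ - c₂) ^ 2) / 2)) := by
  sorry

/-! ## Card `funnels-not-walls` -/

/-- FIRST LEMMA (walls are paid in area): if a subset `A ⊆ N` contains the vertical wall
`S × [a, b]` over a subset `S` of the slice `S⁴ × {0}`, then `cylEnt A ≥ (b - a)·μH[3](S)/vol(S⁴)`
(the `τ → ∞` limit of `F̂` is area/vol, and `μH[4](S × [a,b]) ≥ (b-a)·μH[3](S)`). With the area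
budget this caps the height of any wall over a closed 3-manifold `S`; the Bernstein–Wang import
(arXiv:2003.13858, Thm 1.1) then says what a TALL thin wall can carry: only round-isotopic
3-spheres. -/
theorem wall_cost
    (A S : Set (EuclideanSpace ℝ (Fin 6))) (a b : ℝ) (hab : a ≤ b)
    (hS : ∀ z ∈ S, z 5 = 0 ∧ ∑ i : Fin 5, z (Fin.castSucc i) ^ 2 = 1) (hSm : MeasurableSet S)
    (hwall : {w | ∃ z ∈ S, ∃ t ∈ Set.Icc a b,
      w = z + t • EuclideanSpace.single (5 : Fin 6) (1 : ℝ)} ⊆ A) :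
    ENNReal.ofReal (b - a) * μH[3] S *
      (μH[4] (Metric.sphere (0 : EuclideanSpace ℝ (Fin 5)) 1))⁻¹ ≤ cylEnt A := by
  sorry

end

end Summit.SmoothPoincare4.SmoothPoincare4.Cruxes.ThinCrossSectionExists.Sketch
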